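import Mathlib
import Literature.MathematicalPhysics.QuantumFieldTheory.Balaban1983to89.T3ThresholdRemoval
import Literature.MathematicalPhysics.QuantumFieldTheory.Balaban1983to89.T3OrbitAverage

/-!
# Thin-set transfer of the continuum limit to unit-lattice observables continuous OFF a thin set (helper file 1/2 for
# `GuardedTransfer`, route GuardedThresholdRemoval, crux r3, stmt-QuantumFields-28026)

§1  The Lévy transfer of `T3ThresholdRemoval.exists_tendsto_integral_unitLaw`, verbatim for an ARBITRARY measurable small-loop
    average `ℰ` on `SU(2)` (the tree states it at the continuous `ℰc`; its proof never uses continuity of `ℰ`):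
    `HasContinuumLimit (F.scheme ℰ γ)` ⇒ `∫ f d(unitLaw_K)` converges for every continuous gauge-invariant bounded measurable `f`
    ([Levy2004] Thm 3.1 density of the Wilson-loop algebra, tree `LevyDensity.dense_su2_of_connected`, + ε/3).
§2  UPGRADE TO OBSERVABLES CONTINUOUS OFF A THIN SET: if `f` is bounded, measurable, gauge invariant and, for every `ε > 0`,
    continuous on a closed gauge-invariant set `s` with `unitLaw_K(sᶜ) ≤ ε` for `K ≥ K₀`, then `∫ f d(unitLaw_K)` converges —
    Tietze extension of `f|s` (Mathlib `ContinuousMap.exists_restrict_eq_forall_mem_of_closed`), ORBIT AVERAGE over the gauge group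
    (tree `T3OrbitAverage.orbAvg`: continuous, invariant, `= f` on `s`), §1, and a Cauchy ε/3.  This is the portmanteau /
    mapping-theorem step of [Billingsley1999] Thm 2.7 p. 25 in the tree's moment language.

HONEST FRAMING.  Pure transfer lemmas (rung R3 RECORD line; no summit statement and no instance of `ContinuumYM3Torus` is proved
here; the YM mass gap is NOT proved by any of this).  Sources: [Levy2004] Thm 3.1, [Billingsley1999] Thm 2.7 p. 25,
[Balaban1985Averaging] (12) p. 19 (gauge-invariant functions / orbit average), [JaffeWittenClay2006] §6.5 p. 11.
-/

noncomputable section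

namespace Summit.QuantumFields.YangMills.Theorems.ThinSetTransfer

open MeasureTheory Filter Topology
open Literature.MathematicalPhysics.QuantumFieldTheory.Balaban1983to89
open Literature.MathematicalPhysics.QuantumFieldTheory.Balaban1983to89.T3ContinuumYM3Torus
open Literature.MathematicalPhysics.QuantumFieldTheory.Balaban1983to89.T3LevelShift
open Literature.MathematicalPhysics.QuantumFieldTheory.Balaban1983to89.Missing
open Literature.MathematicalPhysics.QuantumFieldTheory.Balaban1983to89.T4Continuum
open Literature.MathematicalPhysics.QuantumFieldTheory.Balaban1983to89.T3ThresholdRemoval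
open Literature.MathematicalPhysics.QuantumFieldTheory.Balaban1983to89.T3OrbitAverage

/-! ## §0 Local helpers -/

/-- Products of a list of measurable real functions are measurable (local helper). [folklore] -/
private theorem measurable_list_prod {X : Type*} [MeasurableSpace X] {ι : Type*} (f : ι → X → ℝ)
    (hf : ∀ i, Measurable (f i)) : ∀ l : List ι, Measurable fun x => (l.map fun i => f i x).prod
  | [] => by simp
  | i :: l => by
    show Measurable fun x => f i x * (l.map fun i => f i x).prod
    exact (hf i).mul (measurable_list_prod f hf l)

/-- Products of a list of functions bounded by `1` are bounded by `1` (local helper). [folklore] -/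
private theorem abs_list_prod_le_one {X : Type*} {ι : Type*} (f : ι → X → ℝ) (hf : ∀ i x, |f i x| ≤ 1) (x : X) :
    ∀ l : List ι, |(l.map fun i => f i x).prod| ≤ 1
  | [] => by simp
  | i :: l => by
    rw [List.map_cons, List.prod_cons, abs_mul]
    exact mul_le_one₀ (hf i x) (abs_nonneg _) (abs_list_prod_le_one f hf x l)

/-- A real sequence approximable to every accuracy, FROM SOME INDEX ON, by convergent sequences converges (Cauchy, `ℝ`
complete). [folklore] -/
private theorem exists_tendsto_of_forall_eventually_approx {a : ℕ → ℝ}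
    (h : ∀ ε > 0, ∃ b : ℕ → ℝ, (∃ l, Tendsto b atTop (𝓝 l)) ∧ ∃ K₀, ∀ K, K₀ ≤ K → |a K - b K| ≤ ε) :
    ∃ l, Tendsto a atTop (𝓝 l) := by
  apply cauchySeq_tendsto_of_complete
  rw [Metric.cauchySeq_iff]
  intro ε hε
  obtain ⟨b, ⟨l, hb⟩, K₀, hab⟩ := h (ε / 3) (by positivity)
  obtain ⟨N, hN⟩ := Metric.cauchySeq_iff.mp hb.cauchySeq (ε / 3) (by positivity)
  refine ⟨max N K₀, fun p hp q hq => ?_⟩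
  have h1 := hab p (le_of_max_le_right hp)
  have h2 := hab q (le_of_max_le_right hq)
  have h3 := hN p (le_of_max_le_left hp) q (le_of_max_le_left hq)
  rw [Real.dist_eq] at h3 ⊢
  calc |a p - a q| = |(a p - b p) + (b p - b q) + (b q - a q)| := by ring_nf
    _ ≤ |a p - b p| + |b p - b q| + |b q - a q| := abs_add_three _ _ _
    _ < ε := by rw [abs_sub_comm (b q) (a q)]; linarith

/-- Convergence of integrals against a sequence of probability laws passes to the real LINEAR SPAN of a class of bounded measurable
functions (with the bound and the measurability). [folklore] -/
private theorem tendsto_integral_of_mem_span {X : Type*} [MeasurableSpace X] (μ : ℕ → Measure X)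
    [∀ K, IsProbabilityMeasure (μ K)] {S : Set (X → ℝ)}
    (hS : ∀ q ∈ S, (∃ B, ∀ u, |q u| ≤ B) ∧ Measurable q ∧ ∃ l, Tendsto (fun K => ∫ u, q u ∂μ K) atTop (𝓝 l))
    {p : X → ℝ} (hp : p ∈ Submodule.span ℝ S) :
    (∃ B, ∀ u, |p u| ≤ B) ∧ Measurable p ∧ ∃ l, Tendsto (fun K => ∫ u, p u ∂μ K) atTop (𝓝 l) := by
  induction hp using Submodule.span_induction with
  | mem q hq => exact hS q hq
  | zero => exact ⟨⟨0, fun u => by simp⟩, measurable_const, ⟨0, by simp⟩⟩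
  | add p q _ _ hp hq =>
    obtain ⟨⟨Bp, hBp⟩, hpm, lp, hlp⟩ := hp
    obtain ⟨⟨Bq, hBq⟩, hqm, lq, hlq⟩ := hq
    refine ⟨⟨Bp + Bq, fun u => (abs_add_le _ _).trans (add_le_add (hBp u) (hBq u))⟩, hpm.add hqm, ⟨lp + lq, ?_⟩⟩
    have he : (fun K => ∫ u, (p + q) u ∂μ K) = fun K => ∫ u, p u ∂μ K + ∫ u, q u ∂μ K := funext fun K =>
      integral_add (T4VarianceMatching.integrable_of_abs_le (μ K) hpm hBp)
        (T4VarianceMatching.integrable_of_abs_le (μ K) hqm hBq)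
    rw [he]
    exact hlp.add hlq
  | smul a p _ hp =>
    obtain ⟨⟨Bp, hBp⟩, hpm, lp, hlp⟩ := hp
    refine ⟨⟨|a| * Bp, fun u => ?_⟩, hpm.const_mul a, ⟨a * lp, ?_⟩⟩
    · rw [Pi.smul_apply, smul_eq_mul, abs_mul]
      exact mul_le_mul_of_nonneg_left (hBp u) (abs_nonneg a)
    · have he : (fun K => ∫ u, (a • p) u ∂μ K) = fun K => a * ∫ u, p u ∂μ K := funext fun K => by
        simp only [Pi.smul_apply, smul_eq_mul]
        exact integral_const_mul a _
      rw [he]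
      exact hlp.const_mul a

/-! ## §1 The Lévy transfer for an arbitrary measurable small-loop average -/

section Levy

open Literature.MathematicalPhysics.QuantumLattice

/-- **EXISTENCE OF THE CONTINUUM LIMIT PROPAGATES FROM LOOP STRINGS TO EVERY CONTINUOUS GAUGE-INVARIANT UNIT-LATTICE OBSERVABLE**,
for an ARBITRARY measurable small-loop average `ℰ` on `SU(2)` (the tree's `T3ThresholdRemoval.exists_tendsto_integral_unitLaw` is
the case `ℰ = expMeanLogSUc`; the proof is the same: Lévy's density of the Wilson-loop algebra on the finite connected unit graph
+ ε/3, continuity of `ℰ` is never used). [cite: Levy2004, Thm 3.1] -/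
theorem exists_tendsto_integral_unitLaw_of_measurableE (F : T3Family)
    (ℰ : LoopAverage (Matrix.specialUnitaryGroup (Fin 2) ℂ)) (hE : ℰ.MeasurableE) {γ : ℝ} (hγ : 0 ≤ γ)
    (h : HasContinuumLimit (F.scheme ℰ γ))
    {f : GaugeField (F.P 0) 0 (Matrix.specialUnitaryGroup (Fin 2) ℂ) → ℝ} (hfc : Continuous f)
    (hfi : ∀ (u : GaugeTransf (F.P 0) 0 (Matrix.specialUnitaryGroup (Fin 2) ℂ)) (U : GaugeField (F.P 0) 0 _),
      f (GaugeField.gaugeAct u U) = f U)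
    (hfm : Measurable f) {B : ℝ} (hfb : ∀ u, |f u| ≤ B) :
    ∃ l, Tendsto (fun K => ∫ u, f u ∂F.unitLaw ℰ hE γ K) atTop (𝓝 l) := by
  -- the unit laws
  let μ : ℕ → Measure (GaugeField (F.P 0) 0 (Matrix.specialUnitaryGroup (Fin 2) ℂ)) := fun K => F.unitLaw ℰ hE γ K
  haveI : ∀ K, IsProbabilityMeasure (μ K) := fun K => isProbabilityMeasure_unitLaw hE hγ K
  -- the generators of the graph algebra have convergent integrals (they are constants times scheme strings)
  have hgen : ∀ q ∈ LevyDensity.loopTraceProducts (PBond.src (P := F.P 0) (j := 0)) PBond.tgt (fundamentalRep (Fin 2))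
      (0 : F.USite), (∃ B, ∀ u, |q u| ≤ B) ∧ Measurable q ∧ ∃ l, Tendsto (fun K => ∫ u, q u ∂μ K) atTop (𝓝 l) := by
    rintro q ⟨l, rfl⟩
    obtain ⟨c, Cs, hq⟩ := loopTraceProduct_eq_string (F := F) l
    rw [hq]
    refine ⟨⟨|c|, fun u => ?_⟩, (measurable_list_prod
      (fun (C : ULoop3 F) (u : GaugeField (F.P 0) 0 (Matrix.specialUnitaryGroup (Fin 2) ℂ)) => loopAt u (C.1.atLevel 0))
      (fun C => measurable_loopAt _) Cs).const_mul c, ?_⟩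
    · rw [abs_mul]
      exact mul_le_of_le_one_right (abs_nonneg c) (abs_list_prod_le_one
        (fun (C : ULoop3 F) (u : GaugeField (F.P 0) 0 (Matrix.specialUnitaryGroup (Fin 2) ℂ)) => loopAt u (C.1.atLevel 0))
        (fun _ _ => abs_loopAt_le_one _ _) u Cs)
    · obtain ⟨l₀, hl₀⟩ := h Cs
      refine ⟨c * l₀, ?_⟩
      have he : (fun K => ∫ u, c * (Cs.map fun C => loopAt u (C.1.atLevel 0)).prod ∂μ K) =
          fun K => c * (F.scheme ℰ γ).expectAt K Cs := funext fun K => by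
        rw [integral_const_mul, expectAt_eq_integral_unitLaw hE hγ K Cs]
      rw [he]
      exact hl₀.const_mul c
  -- Lévy + ε/3
  refine exists_tendsto_of_forall_eventually_approx fun ε hε => ?_
  obtain ⟨p, hp, hfp⟩ := LevyDensity.dense_su2_of_connected (PBond.src (P := F.P 0) (j := 0)) PBond.tgt
    (v₀ := (0 : F.USite)) exists_isPath_zero (F := f) hfc hfi hε
  obtain ⟨⟨B', hB'⟩, hpm, l, hl⟩ := tendsto_integral_of_mem_span μ hgen hp
  refine ⟨fun K => ∫ u, p u ∂μ K, ⟨l, hl⟩, 0, fun K _ => ?_⟩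
  rw [← integral_sub (T4VarianceMatching.integrable_of_abs_le (μ K) hfm hfb)
    (T4VarianceMatching.integrable_of_abs_le (μ K) hpm hB')]
  have hb := norm_integral_le_of_norm_le_const (μ := μ K) (f := fun u => f u - p u) (C := ε)
    (Eventually.of_forall fun u => by simpa [Real.norm_eq_abs] using hfp u)
  simpa [Real.norm_eq_abs] using hb

end Levy

/-! ## §2 Upgrade: observables continuous off a thin closed gauge-invariant set -/

section Thin

variable (F : T3Family) (ℰ : LoopAverage (Matrix.specialUnitaryGroup (Fin 2) ℂ)) (hE : ℰ.MeasurableE)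

/-- On a gauge-invariant set `s` on which the bounded function `f` is gauge invariant, the ORBIT AVERAGE of any extension `g` of
`f|s` agrees with `f` on `s`. [cite: Balaban1985Averaging, (12) p.19] -/
theorem orbAvg_eq_of_eqOn {P : Params} {j : ℕ} {s : Set (GaugeField P j (Matrix.specialUnitaryGroup (Fin 2) ℂ))}
    (hs : ∀ (v : Site P j → Matrix.specialUnitaryGroup (Fin 2) ℂ) (U : GaugeField P j (Matrix.specialUnitaryGroup (Fin 2) ℂ)),
      U ∈ s → GaugeField.gaugeAct v U ∈ s)
    {f g : GaugeField P j (Matrix.specialUnitaryGroup (Fin 2) ℂ) → ℝ}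
    (hfi : ∀ (v : Site P j → Matrix.specialUnitaryGroup (Fin 2) ℂ) (U : GaugeField P j (Matrix.specialUnitaryGroup (Fin 2) ℂ)),
      f (GaugeField.gaugeAct v U) = f U)
    (hfg : ∀ U ∈ s, g U = f U) {U : GaugeField P j (Matrix.specialUnitaryGroup (Fin 2) ℂ)} (hU : U ∈ s) :
    orbAvg g U = f U := by
  unfold orbAvg
  have h : (fun v : Site P j → Matrix.specialUnitaryGroup (Fin 2) ℂ => g (GaugeField.gaugeAct v U)) = fun _ => f U :=
    funext fun v => by rw [hfg _ (hs v U hU), hfi]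
  rw [h, integral_const, smul_eq_mul, probReal_univ, one_mul]

/-- **THE THIN-SET UPGRADE OF THE LÉVY TRANSFER** (the portmanteau / mapping-theorem step of [Billingsley1999] Thm 2.7 in the
tree's moment language).  Let `ℰ` be a measurable small-loop average on `SU(2)`, `γ ≥ 0`, and suppose the scheme of `F` has the
full-sequence continuum limit.  Let `f` be a bounded measurable gauge-invariant function of the unit field such that for every
`ε > 0` there is a CLOSED gauge-invariant set `s` on which `f` is continuous and whose complement has unit-law mass `≤ ε` for all
`K ≥ K₀`.  Then `∫ f d(unitLaw_K)` converges.  Proof: Tietze-extend `f|s`, orbit-average the extension (continuous, invariant,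
`= f` on `s`), apply the Lévy transfer to it, and bound the difference by `2B·ε`. [cite: Billingsley1999, Thm 2.7 p.25] -/
theorem exists_tendsto_integral_unitLaw_of_thin {γ : ℝ} (hγ : 0 ≤ γ) (h : HasContinuumLimit (F.scheme ℰ γ))
    {f : GaugeField (F.P 0) 0 (Matrix.specialUnitaryGroup (Fin 2) ℂ) → ℝ} (hfm : Measurable f) {B : ℝ} (hfb : ∀ u, |f u| ≤ B)
    (hfi : ∀ (v : Site (F.P 0) 0 → Matrix.specialUnitaryGroup (Fin 2) ℂ) (U : GaugeField (F.P 0) 0 _),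
      f (GaugeField.gaugeAct v U) = f U)
    (hthin : ∀ ε : ℝ, 0 < ε → ∃ s : Set (GaugeField (F.P 0) 0 (Matrix.specialUnitaryGroup (Fin 2) ℂ)),
      IsClosed s ∧ (∀ (v : Site (F.P 0) 0 → Matrix.specialUnitaryGroup (Fin 2) ℂ) (U : GaugeField (F.P 0) 0 _),
        U ∈ s → GaugeField.gaugeAct v U ∈ s) ∧ ContinuousOn f s ∧
        ∃ K₀ : ℕ, ∀ K : ℕ, K₀ ≤ K → (F.unitLaw ℰ hE γ K).real sᶜ ≤ ε) :
    ∃ l, Tendsto (fun K => ∫ u, f u ∂F.unitLaw ℰ hE γ K) atTop (𝓝 l) := by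
  let μ : ℕ → Measure (GaugeField (F.P 0) 0 (Matrix.specialUnitaryGroup (Fin 2) ℂ)) := fun K => F.unitLaw ℰ hE γ K
  haveI hμ : ∀ K, IsProbabilityMeasure (μ K) := fun K => isProbabilityMeasure_unitLaw hE hγ K
  have hB : 0 ≤ B := (abs_nonneg _).trans (hfb 1)
  refine exists_tendsto_of_forall_eventually_approx fun ε hε => ?_
  -- the thin closed invariant set at accuracy ε / (2B + 1)
  have hε' : 0 < ε / (2 * B + 1) := div_pos hε (by linarith)
  obtain ⟨s, hsc, hsi, hfs, K₀, hK₀⟩ := hthin (ε / (2 * B + 1)) hε'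
  -- Tietze: a continuous extension `g` of `f|s` with values in `[-B, B]`
  let fs : C(s, ℝ) := ⟨s.restrict f, hfs.restrict⟩
  obtain ⟨g, hgB, hgf⟩ := fs.exists_restrict_eq_forall_mem_of_closed (t := Set.Icc (-B) B)
    (fun x => abs_le.mp (hfb x.1)) ⟨0, by simp [hB]⟩ hsc
  have hgf' : ∀ U ∈ s, g U = f U := fun U hU => by
    have := congrArg (fun h : C(s, ℝ) => h ⟨U, hU⟩) hgf
    simpa [fs] using this
  have hgb : ∀ U, |g U| ≤ B := fun U => abs_le.mpr (hgB U)
  -- its orbit average: continuous, invariant, bounded, `= f` on `s`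
  have hgc : Continuous (orbAvg g) := continuous_orbAvg g.continuous
  have hgi : ∀ (v : Site (F.P 0) 0 → Matrix.specialUnitaryGroup (Fin 2) ℂ) (U : GaugeField (F.P 0) 0 _),
      orbAvg g (GaugeField.gaugeAct v U) = orbAvg g U := fun v U => orbAvg_gaugeAct g v U
  have hgm : Measurable (orbAvg g) := measurable_orbAvg g.continuous
  have hgb' : ∀ U, |orbAvg g U| ≤ B := fun U => abs_orbAvg_le hgb U
  have hgs : ∀ U ∈ s, orbAvg g U = f U := fun U hU => orbAvg_eq_of_eqOn hsi hfi hgf' hU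
  -- Lévy transfer for the orbit average
  obtain ⟨l, hl⟩ := exists_tendsto_integral_unitLaw_of_measurableE F ℰ hE hγ h hgc hgi hgm hgb'
  refine ⟨fun K => ∫ u, orbAvg g u ∂μ K, ⟨l, hl⟩, K₀, fun K hK => ?_⟩
  -- the difference is carried by `sᶜ`
  have hsm : MeasurableSet sᶜ := hsc.measurableSet.compl
  have hpt : ∀ u, ‖f u - orbAvg g u‖ ≤ sᶜ.indicator (fun _ => 2 * B) u := fun u => by
    by_cases hu : u ∈ s
    · simp [Set.indicator_of_notMem (show u ∉ sᶜ from fun h => h hu), hgs u hu]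
    · rw [Set.indicator_of_mem (show u ∈ sᶜ from hu), Real.norm_eq_abs]
      calc |f u - orbAvg g u| ≤ |f u| + |orbAvg g u| := abs_sub _ _
        _ ≤ B + B := add_le_add (hfb u) (hgb' u)
        _ = 2 * B := by ring
  rw [← integral_sub (T4VarianceMatching.integrable_of_abs_le (μ K) hfm hfb)
    (T4VarianceMatching.integrable_of_abs_le (μ K) hgm hgb')]
  have hint : Integrable (sᶜ.indicator fun _ => (2 * B : ℝ)) (μ K) := (integrable_const _).indicator hsm
  calc |∫ u, f u - orbAvg g u ∂μ K| = ‖∫ u, f u - orbAvg g u ∂μ K‖ := (Real.norm_eq_abs _).symm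
    _ ≤ ∫ u, sᶜ.indicator (fun _ => (2 * B : ℝ)) u ∂μ K := norm_integral_le_of_norm_le hint (Eventually.of_forall hpt)
    _ = (μ K).real sᶜ * (2 * B) := by rw [integral_indicator_const _ hsm, smul_eq_mul]
    _ ≤ ε / (2 * B + 1) * (2 * B) := mul_le_mul_of_nonneg_right (hK₀ K hK) (by linarith)
    _ ≤ ε := by
        rw [div_mul_eq_mul_div, div_le_iff₀ (by linarith : (0 : ℝ) < 2 * B + 1)]
        nlinarith

end Thin

end Summit.QuantumFields.YangMills.Theorems.ThinSetTransfer

end
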